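import Literature.MathematicalPhysics.QuantumFieldTheory.Balaban1983to89.B5Eq119GaussianV1
import Literature.MathematicalPhysics.QuantumFieldTheory.BalabanImbrieJaffe1984to88.BIJ85AxialMinimizer413

/-!
# `Balaban1983to89.B5Eq165AxialMinV1` — T. Bałaban, *Propagators and renormalization transformations for lattice gauge
theories. I*, Commun. Math. Phys. **95** (1984) 17–40 [Balaban1984PropagatorsI], (1.64)–(1.65) p. 29 IN THE AXIAL GAUGE, on the V1
lattice calculus: the quadratic form `⟨B, Δ_kB⟩` of (1.19) is TWICE THE MINIMUM of the action over the fibre of (1.17), attained exactly at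
the axial gauge minimizer `H_{k,Ax}B` of T. Bałaban, J. Imbrie, A. Jaffe, *Renormalization of the Higgs model: minimizers, propagators
and the stability of mean field theory*, Commun. Math. Phys. **97** (1985) 299–329 [BalabanImbrieJaffe1985] (4.1.3)–(4.1.5) p. 310 —
which is the explicit least-squares point of the fibre

statement-level skeleton of published theorems with citation tags; proofs where landed; nothing here is a claim about the Yang–Mills mass gap

PDF held: `paper:balaban1984-cmp95-propagators-rt-i` (journal page = PDF page + 16), p. 29 [PDF 13]; `paper:balaban1985-cmp97-bij-higgs-minimizers`,
p. 310 [PDF 12]; both read from the text layer.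

PRINT, verbatim.  [Balaban1984PropagatorsI] p. 29: "Using (1.60), or better (1.63), we can verify all the properties of `H_kB`: `Q_kH_kB = B`,
`R∂*H_kB = 0`, `H_kB` is a minimum of `½⟨∂A, ∂A⟩` on the hyperplane `{A : Q_kA = B, R∂*A = 0}` … we get `(1.47) = Z_k exp(−½⟨∂H_kB, ∂H_kB⟩)`.
(1.64)  The action `Δ_k` is thus defined by `⟨B, Δ_kB⟩ = ⟨∂H_kB, ∂H_kB⟩`. (1.65)".  [BalabanImbrieJaffe1985] p. 310: "`H_{k,Ax}` which maps `B`
into such a minimizing configuration for axial gauge, and we call `H_{k,Ax}` the axial gauge minimizer. Explicitly, `H_{k,Ax}B = Z_{k,Ax}(B)⁻¹∫…`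
(4.1.3) where `Z_{k,Ax}(B) = ∫dA δ(Q_kA − B)δ_{k,Ax}(A)exp(−½‖∂A‖²)`. (4.1.4)  Note that by definition `Q_kH_{k,Ax}B = B`. (4.1.5)".

CITATION HEADER (lean-in-tree rule) — WHAT IS REPRODUCED.  Phase-2 proof file of the lit-balaban typed skeleton (HOME
`run/shared/lean/pub/lit-balaban/`), seat p38 (gen 2), a KNITTING file: rows `B5.Eq1.64`/`B5.Eq1.66` ((1.64)/(1.65); fold owner r02; torus
decls of record in the LANDAU gauge `B5Eq165DeltaK.eq164`/`eq165`, seat p16, and `B5TowerOneStroke.isLeast_actionEta_DelK`, seat p21) and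
`C1.Eq4.1.3-4.1.5` (seat p09, `BIJ85AxialMinimizer413.torusHax`/`torus_minimizes`/`torus_eq415` on the V1 carrier `VecField P 0 ℝ`), knitted
to the V1 Gaussian form of (1.19) `B5Eq119GaussianV1.DeltaK` (this seat).  THE PRINTED (1.64)/(1.65) ARE IN THE LANDAU GAUGE (minimum over
`{Q_kA = B, R∂*A = 0}`); THIS FILE STATES AND PROVES THEIR AXIAL-GAUGE COUNTERPART (minimum over the fibre `{Q_kA = B, δ_Ax(Q_{k−1}A)⋯δ_Ax(A)}` of
(1.17), BIJ85 §4.1's "minimizing configuration for axial gauge"); the equality of the two minima is the exchange of gauges (1.47) (torus: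
`B5Eq147Landau`, seat p16) and is NOT asserted here.  Everything is over the carriers OF RECORD (`LatticeFieldCalculus`, `B5Eq112RenormTransf`,
`B5Eq117CompositionV1`, `B5Eq119GaussianV1`, `BIJ85AxialPropagator411`, `BIJ85AxialMinimizer413`, `BIJ85NoZeroModes309Torus.hD_holds`) BY NAME.
WHAT IS PROVED (kernel; standard axioms; `k ≤ m + K`, `w > 0`, `c ≠ 0`): the explicit least-squares point of the fibre `axMin`
(`= faceFieldIter k B − N_k(S_k^*S_k)⁻¹S_k^*s_k(B)`) lies in the fibre and has action `½⟨B, Δ_kB⟩` (`curlAction_axMin`); every point of the fibre has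
action `≥ ½⟨B, Δ_kB⟩` (`curlAction_ge_of_mem_fibreIter`, Pythagoras against the orthogonal projection `R_k`); hence **`½⟨B, Δ_kB⟩ = min_{fibre} S`**
(`isLeast_curlAction_fibreIter`), **`⟨B, Δ_kB⟩ = 2S(H_{k,Ax}B) = ‖√w∂H_{k,Ax}B‖²`** for BIJ85's axial minimizer of the section (`dotProduct_DeltaK_eq_torusHax`,
the axial (1.65)), **`H_{k,Ax}B` IS the least-squares point** (`torusHax_faceFieldIter_eq_axMin`, uniqueness of the minimum), and the axial (1.64)
`((ST)^k e^{−S})(B) = Z_{k,Ax}·exp(−S(H_{k,Ax}B))` (`eq164_axial`).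

Unit `lit-balaban-p38` (literature-prover-lit-balaban-p38-g2-0), 2026-08-21.
-/

open scoped BigOperators RealInnerProductSpace

namespace Literature.MathematicalPhysics.QuantumFieldTheory.Balaban1983to89

namespace B5Eq165AxialMinV1

open LatticeFieldCalculus MeasureTheory Matrix B5Eq112RenormTransf B5Eq117CompositionV1 B5Eq119GaussianV1
open B9Eq3170 (IsBasisOf)
open Literature.MathematicalPhysics.QuantumFieldTheory.BalabanImbrieJaffe1984to88.BIJ85AxialPropagator411
  (constraint411 mem_constraint411 PlaqSpace BondSpace toE curlOp half_norm_curlOp_sq formInv V411 mem_V411)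
open Literature.MathematicalPhysics.QuantumFieldTheory.BalabanImbrieJaffe1984to88.BIJ85AxialMinimizer413
  (Hax torusHax Hax_sub_mem eq_Hax_of_norm_le noZeroModes_V411 torus_minimizes)
open Literature.MathematicalPhysics.QuantumFieldTheory.BalabanImbrieJaffe1984to88.BIJ85NoZeroModes309Torus (hD_holds)

noncomputable section

variable {P : Params} {k : ℕ} {w c : ℝ}

/-- THE LEAST-SQUARES POINT of the fibre of (1.17) over `B`: `faceFieldIter k B − N_k(S_k^*S_k)⁻¹S_k^*s_k(B)` (the fibre coordinate at which
`½‖S_ku + s_k(B)‖²` is least). [cite: BalabanImbrieJaffe1985, (4.1.3) p.310] -/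
def axMin (P : Params) (k : ℕ) (w c : ℝ) (B : VecField P k ℝ) : VecField P 0 ℝ :=
  faceFieldIter k B -
    kerEmb P k (formInv (curlCoord P k w c) (LinearMap.adjoint (curlCoord P k w c) (secCurl P k w c B)))

/-- The least-squares point differs from the section by a fibre direction. [cite: BalabanImbrieJaffe1985, (4.1.5) p.310] -/
theorem axMin_sub_mem (B : VecField P k ℝ) :
    axMin P k w c B - faceFieldIter k B ∈ (constraint411 k : Submodule ℝ (VecField P 0 ℝ)) := by
  rw [axMin, sub_sub_cancel_left]
  exact Submodule.neg_mem _ (kerEmb_mem k _)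

/-- The least-squares point lies in the fibre `{Q_kA = B, δ_Ax(Q_{k−1}A)⋯δ_Ax(A)}` (in particular `Q_k(axMin B) = B`, cf. (4.1.5)).
[cite: BalabanImbrieJaffe1985, (4.1.5) p.310] -/
theorem axMin_mem_fibreIter (hk : k ≤ P.m + P.K) (B : VecField P k ℝ) : axMin P k w c B ∈ fibreIter k B :=
  (mem_fibreIter_iff hk B _).2 (axMin_sub_mem B)

/-- THE ACTION AT THE LEAST-SQUARES POINT is `½‖W_kB‖² = ½⟨B, Δ_kB⟩`. [cite: Balaban1984PropagatorsI, (1.65) p.29] -/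
theorem curlAction_axMin (hk : k ≤ P.m + P.K) (hw : 0 < w) (hc : c ≠ 0) (B : VecField P k ℝ) :
    curlAction w c (axMin P k w c B) = (1 / 2) * (B ⬝ᵥ (DeltaK P k w c *ᵥ B)) := by
  have h : axMin P k w c B = faceFieldIter k B + kerBasisIter P k *ᵥ WithLp.ofLp
      (-(formInv (curlCoord P k w c) (LinearMap.adjoint (curlCoord P k w c) (secCurl P k w c B)))) := by
    rw [axMin, sub_eq_add_neg, ← map_neg, kerEmb_apply]
  rw [h, curlAction_fibre hw.le, map_neg, neg_add_eq_sub, dotProduct_DeltaK_mulVec_self, wOp_apply, projK_apply_eq hk hw hc]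

/-- THE LOWER BOUND ON THE FIBRE: `S(A) ≥ ½⟨B, Δ_kB⟩` for every `A` of the fibre over `B` (Pythagoras against the orthogonal projection
`R_k` onto the curvatures of the fibre directions). [cite: Balaban1984PropagatorsI, (1.65) p.29] -/
theorem curlAction_ge_of_mem_fibreIter (hk : k ≤ P.m + P.K) (hw : 0 < w) {B : VecField P k ℝ}
    {A : VecField P 0 ℝ} (hA : A ∈ fibreIter k B) : (1 / 2) * (B ⬝ᵥ (DeltaK P k w c *ᵥ B)) ≤ curlAction w c A := by
  obtain ⟨u, hu⟩ := ((isBasisOf_kerBasisIter (P := P) k).mem_iff _).1 ((mem_fibreIter_iff hk B A).1 hA)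
  have hA' : A = faceFieldIter k B + kerBasisIter P k *ᵥ WithLp.ofLp (WithLp.toLp 2 u) := by
    rw [WithLp.ofLp_toLp, hu]
    abel
  have hx : secCurl P k w c B - projK P k w c (secCurl P k w c B) ∈ (LinearMap.range (curlCoord P k w c))ᗮ := by
    unfold projK
    exact Submodule.sub_starProjection_mem_orthogonal _
  have hy : projK P k w c (secCurl P k w c B) + curlCoord P k w c (WithLp.toLp 2 u) ∈ LinearMap.range (curlCoord P k w c) := by
    refine Submodule.add_mem _ ?_ (LinearMap.mem_range_self _ _)
    unfold projK
    exact Submodule.starProjection_apply_mem _ _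
  have horth : ⟪secCurl P k w c B - projK P k w c (secCurl P k w c B),
      projK P k w c (secCurl P k w c B) + curlCoord P k w c (WithLp.toLp 2 u)⟫ = 0 :=
    Submodule.inner_left_of_mem_orthogonal hy hx
  have hsum : curlCoord P k w c (WithLp.toLp 2 u) + secCurl P k w c B =
      (secCurl P k w c B - projK P k w c (secCurl P k w c B)) +
        (projK P k w c (secCurl P k w c B) + curlCoord P k w c (WithLp.toLp 2 u)) := by
    abel
  rw [hA', curlAction_fibre hw.le, dotProduct_DeltaK_mulVec_self, wOp_apply, hsum, norm_add_sq_real, horth, mul_zero, add_zero]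
  nlinarith [sq_nonneg ‖projK P k w c (secCurl P k w c B) + curlCoord P k w c (WithLp.toLp 2 u)‖]

/-- **`½⟨B, Δ_kB⟩` IS THE MINIMUM OF THE ACTION OVER THE FIBRE of (1.17)** — the axial-gauge counterpart of p. 29 "`H_kB` is a minimum of
`½⟨∂A, ∂A⟩` on the hyperplane …", (1.65) (torus, Landau gauge: `B5Eq165DeltaK.eq165`; torus, axial fibre: `B5TowerOneStroke.isLeast_actionEta_DelK`).
[cite: Balaban1984PropagatorsI, (1.65) p.29] -/
theorem isLeast_curlAction_fibreIter (hk : k ≤ P.m + P.K) (hw : 0 < w) (hc : c ≠ 0) (B : VecField P k ℝ) :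
    IsLeast ((curlAction w c) '' fibreIter k B) ((1 / 2) * (B ⬝ᵥ (DeltaK P k w c *ᵥ B))) :=
  ⟨⟨axMin P k w c B, axMin_mem_fibreIter hk B, curlAction_axMin hk hw hc B⟩,
    fun _ ⟨_, hA, hAeq⟩ => hAeq ▸ curlAction_ge_of_mem_fibreIter hk hw hA⟩

/-- BIJ85's axial gauge minimizer of the section lies in the fibre of (1.17) over `B` ((4.1.5) `Q_kH_{k,Ax}B = B` and the axial conditions,
`BIJ85AxialMinimizer413.torus_eq415`). [cite: BalabanImbrieJaffe1985, (4.1.5) p.310] -/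
theorem torusHax_mem_fibreIter (hk : k ≤ P.m + P.K) (hw : 0 < w) (hc : c ≠ 0) (B : VecField P k ℝ) :
    torusHax w c k (faceFieldIter k B) ∈ fibreIter k B := by
  have hD' := noZeroModes_V411 hw c k (hD_holds hk hc)
  have hmem : Hax (V411 P k) (curlOp (P := P) w c) (toE P (faceFieldIter k B)) - toE P (faceFieldIter k B) ∈ V411 P k :=
    Hax_sub_mem hD' _
  have hmem' := (mem_V411 k _).1 hmem
  rw [map_sub, LinearEquiv.symm_apply_apply] at hmem'
  exact (mem_fibreIter_iff hk B _).2 ((mem_constraint411 k _).2 hmem')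

/-- **(1.65) IN THE AXIAL GAUGE / BIJ85 (4.1.3)**: `⟨B, Δ_kB⟩ = 2S(H_{k,Ax}B) = ‖√w·∂H_{k,Ax}B‖²` — the (1.19) form of this seat equals the action
at BIJ85's axial gauge minimizer (seat p09's `torusHax`) of the section, doubled. [cite: Balaban1984PropagatorsI, (1.65) p.29] -/
theorem dotProduct_DeltaK_eq_torusHax (hk : k ≤ P.m + P.K) (hw : 0 < w) (hc : c ≠ 0) (B : VecField P k ℝ) :
    B ⬝ᵥ (DeltaK P k w c *ᵥ B) = 2 * curlAction w c (torusHax w c k (faceFieldIter k B)) := by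
  have h1 := curlAction_ge_of_mem_fibreIter (c := c) hk hw (torusHax_mem_fibreIter hk hw hc B)
  have h2 : curlAction w c (torusHax w c k (faceFieldIter k B)) ≤ curlAction w c (axMin P k w c B) :=
    torus_minimizes hw c k (hD_holds hk hc) (faceFieldIter k B) (axMin_sub_mem B)
  rw [curlAction_axMin hk hw hc] at h2
  linarith

/-- **`H_{k,Ax}B` IS THE LEAST-SQUARES POINT**: BIJ85's (integral-defined) axial gauge minimizer of the section coincides with the explicit
`faceFieldIter k B − N_k(S_k^*S_k)⁻¹S_k^*s_k(B)` (uniqueness of the minimum, `BIJ85AxialMinimizer413.eq_Hax_of_norm_le`).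
[cite: BalabanImbrieJaffe1985, (4.1.3) p.310] -/
theorem torusHax_faceFieldIter_eq_axMin (hk : k ≤ P.m + P.K) (hw : 0 < w) (hc : c ≠ 0) (B : VecField P k ℝ) :
    torusHax w c k (faceFieldIter k B) = axMin P k w c B := by
  have hD' := noZeroModes_V411 hw c k (hD_holds hk hc)
  have hA : toE P (axMin P k w c B) - toE P (faceFieldIter k B) ∈ V411 P k := by
    rw [← map_sub]
    exact Submodule.mem_map_of_mem (axMin_sub_mem B)
  have e1 : (1 / 2) * ‖curlOp (P := P) w c (toE P (axMin P k w c B))‖ ^ 2 = (1 / 2) * (B ⬝ᵥ (DeltaK P k w c *ᵥ B)) := by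
    rw [half_norm_curlOp_sq hw.le, LinearEquiv.symm_apply_apply, curlAction_axMin hk hw hc]
  have e2 : (1 / 2) * ‖curlOp (P := P) w c (Hax (V411 P k) (curlOp (P := P) w c) (toE P (faceFieldIter k B)))‖ ^ 2 =
      (1 / 2) * (B ⬝ᵥ (DeltaK P k w c *ᵥ B)) := by
    rw [half_norm_curlOp_sq hw.le, dotProduct_DeltaK_eq_torusHax hk hw hc, torusHax]
    ring
  have hsq : ‖curlOp (P := P) w c (toE P (axMin P k w c B))‖ ^ 2 =
      ‖curlOp (P := P) w c (Hax (V411 P k) (curlOp (P := P) w c) (toE P (faceFieldIter k B)))‖ ^ 2 := by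
    linarith
  have hle : ‖curlOp (P := P) w c (toE P (axMin P k w c B))‖ ≤
      ‖curlOp (P := P) w c (Hax (V411 P k) (curlOp (P := P) w c) (toE P (faceFieldIter k B)))‖ :=
    le_of_eq ((sq_eq_sq₀ (norm_nonneg _) (norm_nonneg _)).1 hsq)
  have h := eq_Hax_of_norm_le hD' (toE P (faceFieldIter k B)) hA hle
  apply (toE P).injective
  rw [torusHax, LinearEquiv.apply_symm_apply, h]

/-- **(1.64) IN THE AXIAL GAUGE**: `((ST)^k e^{−S})(B) = Z_{k,Ax}·exp(−S(H_{k,Ax}B))` (print, Landau gauge: "(1.47) = Z_k exp(−½⟨∂H_kB, ∂H_kB⟩) (1.64)").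
[cite: Balaban1984PropagatorsI, (1.64) p.29] -/
theorem eq164_axial (hk : k ≤ P.m + P.K) (hw : 0 < w) (hc : c ≠ 0) (B : VecField P k ℝ) :
    rtPow k (fun A => Real.exp (-curlAction w c A)) B =
      zAx P k w c * Real.exp (-curlAction w c (torusHax w c k (faceFieldIter k B))) := by
  rw [eq119 hk hw hc, dotProduct_DeltaK_eq_torusHax hk hw hc]
  congr 2
  ring

end

end B5Eq165AxialMinV1

end Literature.MathematicalPhysics.QuantumFieldTheory.Balaban1983to89
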